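import Mathlib

/-!
# Relations among generators: the ideal of relations `I_F`, the graph ideal `J_F`, the variety
# `V_F`, integrality over the invariants and the orbit space `kⁿ/G ≅ V_F` (Cox–Little–O'Shea, Ch. 7 §4)

[cite: CoxLittleOShea2007, Ch.7 §4 (1), Prop. 1, Prop. 2, Prop. 3 (i) with (2), Def. 6, Prop. 7,
Def. 9, Thm. 10, Lemma 11 (§4 "Relations Among Generators and the Geometry of Orbits" of Ch. 7 "Invariant Theory of
Finite Groups"; numbering as in the held text `book:cox2007-ideals-varieties-algorithms-…`, chunks
p0386–p0393)]

Cox–Little–O'Shea, *Ideals, Varieties, and Algorithms* (3rd ed., Springer UTM 2007), Chapter 7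
§4. Given `f₁, …, f_m ∈ k[x₁, …, xₙ]` (in the book: generators of a ring of invariants
`k[x]^G = k[f₁, …, f_m]`; by Exercise 3 there everything below holds for any `k[f₁, …, f_m]`, and we
state it in that generality), write `F = (f₁, …, f_m)`.

* **(1)** the *ideal of relations* `I_F = {h ∈ k[y₁, …, y_m] : h(f₁, …, f_m) = 0}` (`idealOfRelations`, the
  kernel of `y ↦ f`), and the uniqueness discussion preceding it: `g₁(f) = g₂(f) ⇔ g₁ − g₂ ∈ I_F`
  (`aeval_eq_aeval_iff_sub_mem_idealOfRelations`).
* **Proposition 1.** (i) `I_F` is prime (`idealOfRelations_isPrime`); (ii) if `f = g(f₁, …, f_m)` then all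
  representations of `f` are `g + h`, `h ∈ I_F` (`aeval_eq_aeval_iff_exists_add`).
* **Proposition 2.** `k[y₁, …, y_m]/I_F ≅ k[f₁, …, f_m]`, `[g] ↦ g(f₁, …, f_m)` (`quotIdealOfRelationsEquiv`,
  `quotIdealOfRelationsEquiv_mk`, with `range_aeval_eq_adjoin : k[f₁, …, f_m] = im(y ↦ f)`).
* **Proposition 3 (i)** with its key claim **(2)**: for
  `J_F = ⟨f₁ − y₁, …, f_m − y_m⟩ ⊆ k[x₁, …, xₙ, y₁, …, y_m]`, `p ∈ J_F ⇔ p(x, f₁, …, f_m) = 0`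
  (`mem_relGraphIdeal_iff`), and `I_F = J_F ∩ k[y₁, …, y_m]` is the `n`-th elimination ideal of `J_F`
  (`idealOfRelations_eq_comap_relGraphIdeal`). (Part (ii), the Gröbner-basis form, is not restated.)
* **Definition 6.** `V_F = V(I_F) ⊆ k^m` (`relationVariety`), with the parametrization
  `F : kⁿ → k^m, a ↦ (f₁(a), …, f_m(a))` (`generatorMap`), `F(kⁿ) ⊆ V_F` (`generatorMap_mem_relationVariety`).
* **Proposition 7** (`k` infinite, as in the book where `char k = 0`): (i) `V_F` is the smallest
  variety containing `F(kⁿ)` (`relationVariety_subset_zeroLocus`, `relationVariety_eq_zeroLocus_vanishingIdeal`);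
  (ii) `V_F` is irreducible, in the form `I(V_F)` prime (`vanishingIdeal_relationVariety_isPrime`, the
  dictionary of Ch. 4 §5 Prop. 3); (iii) `I(V_F) = I_F` (`vanishingIdeal_relationVariety`); (iv)
  `k[V_F] ≅ k[f₁, …, f_m]` (`coordRingRelationVarietyEquiv`).
* **Lemma 11.** For a finite group `G` acting on a commutative ring `B` by ring automorphisms (the
  book: a finite matrix group `G ⊆ GL(n, k)` acting on `k[x]` by `(A · f)(x) = f(A · x)`) and
  `f ∈ B`, the polynomial `∏_{A ∈ G} (X − A·f) = X^N + g₁ X^{N−1} + ⋯ + g_N`, `N = |G|`, has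
  `G`-invariant coefficients and `f` as a root: `f^N + g₁ f^{N−1} + ⋯ + g_N = 0`
  (`exists_monic_invariant_coeff_eval_eq_zero`; the polynomial is Mathlib's
  `MulSemiringAction.charpoly G f`, to which we add `natDegree_charpoly`).

* **Definition 9.** For a finite group `G` acting on `k[x₁, …, xₙ]` by `k`-algebra automorphisms (the
  book: `G ⊆ GL(n, k)`), the induced action on points `a ↦ g ⋆ a` of `kⁿ` (`pointAction`, with
  `p(g ⋆ a) = (g⁻¹ • p)(a)`, `eval_pointAction`), the `G`-orbit `G · a` (`pointOrbit`), the relation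
  `∼_G` as an equivalence relation (`pointOrbitRel`) and the *orbit space* `kⁿ/G` (`PointOrbitSpace`).
* **Theorem 10.** Suppose `G` is finite and `k[x]^G = k[f₁, …, f_m]` (hypotheses `hGf`: every invariant
  lies in `k[f₁, …, f_m]`, and `hf`: each `fᵢ` is invariant). (i) For `k` algebraically closed,
  `F : kⁿ → V_F` is onto (`exists_generatorMap_eq`); (ii) `F(a) = F(b) ⇔ b ∈ G · a` — over any field —
  (`generatorMap_eq_generatorMap_iff`), so that `G · a ↦ F(a)` is a bijection `kⁿ/G ≅ V_F`
  (`pointOrbitSpaceEquiv`, `pointOrbitSpaceEquiv_mk`). The proofs go through Mathlib's theory of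
  invariant extensions (`Algebra.IsInvariant.isIntegral`, `Algebra.IsInvariant.exists_smul_of_under_eq`)
  instead of the book's Reynolds operator / Extension Theorem, which removes the characteristic-zero
  hypothesis. Corollary 8 (Zariski closure of `F(kⁿ)` over `ℂ`) is not restated.

Mathlib supplies `RingHom.ker`, `Ideal.quotientKerEquivRange`, `Algebra.adjoin_range_eq_range_aeval`,
the Nullstellensatz dictionary `MvPolynomial.zeroLocus` / `vanishingIdeal`, `MvPolynomial.funext`
(a polynomial over an infinite domain vanishing everywhere is zero) and, for Lemma 11, the polynomial
`MulSemiringAction.charpoly G f = ∏_{g ∈ G} (X − C (g • f))` with `monic_charpoly`,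
`smul_coeff_charpoly`, `eval_charpoly`, and, for Theorem 10, `Algebra.IsInvariant`,
`Algebra.IsInvariant.isIntegral`, `Algebra.IsInvariant.exists_smul_of_under_eq`,
`Ideal.exists_ideal_over_maximal_of_isIntegral`, `MvPolynomial.isMaximal_iff_eq_vanishingIdeal_singleton`
and the pointwise `G`-action on ideals (all used, not restated). No statement of this section is
elsewhere in the tree (the phrase "ideal of relations" occurs in
`PlueckerStraightening.lean` / `GenericTwoByNMinors.lean` for the specific presentations computed there).
-/

noncomputable section

open MvPolynomial

namespace Literature.RingTheory.MvPolynomial.RelationsAmongGenerators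

section Relations

variable {k : Type*} [Field k] {σ ι : Type*} (f : ι → MvPolynomial σ k)

/-- **(1)** (Cox–Little–O'Shea Ch. 7 §4): the *ideal of relations*
`I_F = {h ∈ k[y₁, …, y_m] : h(f₁, …, f_m) = 0 in k[x₁, …, xₙ]}` of `F = (f₁, …, f_m)` — the kernel of
the substitution homomorphism `k[y] → k[x], yᵢ ↦ fᵢ`. [cite: CoxLittleOShea2007, Ch.7 §4 (1)] -/
def idealOfRelations : Ideal (MvPolynomial ι k) :=
  RingHom.ker (aeval f : MvPolynomial ι k →ₐ[k] MvPolynomial σ k)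

/-- `h ∈ I_F ⇔ h(f₁, …, f_m) = 0`. [cite: CoxLittleOShea2007, Ch.7 §4 (1)] -/
theorem mem_idealOfRelations_iff (h : MvPolynomial ι k) : h ∈ idealOfRelations f ↔ aeval f h = 0 :=
  RingHom.mem_ker

/-- The uniqueness discussion before (1) (Cox–Little–O'Shea Ch. 7 §4):
`g₁(f₁, …, f_m) = g₂(f₁, …, f_m) ⇔ h = g₁ − g₂` is a relation, `h ∈ I_F`.
[cite: CoxLittleOShea2007, Ch.7 §4, display before (1)] -/
theorem aeval_eq_aeval_iff_sub_mem_idealOfRelations (g₁ g₂ : MvPolynomial ι k) :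
    aeval f g₁ = aeval f g₂ ↔ g₁ - g₂ ∈ idealOfRelations f := by
  rw [mem_idealOfRelations_iff, map_sub, sub_eq_zero]

/-- **Proposition 1 (i)** (Cox–Little–O'Shea Ch. 7 §4): `I_F` is a prime ideal of `k[y₁, …, y_m]`
(`f(f₁,…)g(f₁,…) = 0` in the domain `k[x]` forces a factor to vanish).
[cite: CoxLittleOShea2007, Ch.7 §4 Prop. 1 (i)] -/
theorem idealOfRelations_isPrime : (idealOfRelations f).IsPrime :=
  RingHom.ker_isPrime _

/-- **Proposition 1 (ii)** (Cox–Little–O'Shea Ch. 7 §4): if `f = g(f₁, …, f_m)` is one representation,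
then all representations are `f = (g + h)(f₁, …, f_m)` as `h` varies over `I_F`.
[cite: CoxLittleOShea2007, Ch.7 §4 Prop. 1 (ii)] -/
theorem aeval_eq_aeval_iff_exists_add (g g' : MvPolynomial ι k) :
    aeval f g' = aeval f g ↔ ∃ h ∈ idealOfRelations f, g' = g + h := by
  rw [aeval_eq_aeval_iff_sub_mem_idealOfRelations]
  constructor
  · intro hmem
    exact ⟨g' - g, hmem, by ring⟩
  · rintro ⟨h, hh, rfl⟩
    simpa using hh

/-- `k[f₁, …, f_m]`, the subalgebra generated by the `fᵢ`, is the image of `y ↦ f`.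
[cite: CoxLittleOShea2007, Ch.7 §4 Prop. 2 (proof: "φ is onto")] -/
theorem range_aeval_eq_adjoin :
    (aeval f : MvPolynomial ι k →ₐ[k] MvPolynomial σ k).range = Algebra.adjoin k (Set.range f) :=
  (Algebra.adjoin_range_eq_range_aeval k f).symm

/-- `I_F` is also the kernel of `y ↦ f` regarded as a map onto its image `k[f₁, …, f_m]`.
[cite: CoxLittleOShea2007, Ch.7 §4 Prop. 2 (proof: "φ is one-to-one")] -/
theorem idealOfRelations_eq_ker_rangeRestrict :
    idealOfRelations f = RingHom.ker (aeval f : MvPolynomial ι k →ₐ[k] MvPolynomial σ k).rangeRestrict :=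
  (AlgHom.ker_rangeRestrict _).symm

/-- **Proposition 2** (Cox–Little–O'Shea Ch. 7 §4): the ring isomorphism
`k[y₁, …, y_m]/I_F ≅ k[f₁, …, f_m]`, `[g] ↦ g(f₁, …, f_m)` (it is the identity on constants, i.e.
a `k`-algebra isomorphism). [cite: CoxLittleOShea2007, Ch.7 §4 Prop. 2] -/
def quotIdealOfRelationsEquiv :
    (MvPolynomial ι k ⧸ idealOfRelations f) ≃ₐ[k]
      (aeval f : MvPolynomial ι k →ₐ[k] MvPolynomial σ k).range :=
  (Ideal.quotientEquivAlgOfEq k (idealOfRelations_eq_ker_rangeRestrict f)).trans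
    (Ideal.quotientKerAlgEquivOfSurjective (AlgHom.rangeRestrict_surjective (aeval f)))

/-- The isomorphism of Prop. 2 is `φ([g]) = g(f₁, …, f_m)`.
[cite: CoxLittleOShea2007, Ch.7 §4 Prop. 2 (definition of φ)] -/
theorem quotIdealOfRelationsEquiv_mk (g : MvPolynomial ι k) :
    (quotIdealOfRelationsEquiv f (Ideal.Quotient.mk (idealOfRelations f) g) : MvPolynomial σ k) = aeval f g := by
  rw [quotIdealOfRelationsEquiv, AlgEquiv.trans_apply, Ideal.quotientEquivAlgOfEq_mk,
    Ideal.quotientKerAlgEquivOfSurjective_mk]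
  rfl

/-! ### Proposition 3: `I_F` as an elimination ideal of the graph ideal `J_F` -/

/-- The ideal `J_F = ⟨f₁ − y₁, …, f_m − y_m⟩ ⊆ k[x₁, …, xₙ, y₁, …, y_m]` (Cox–Little–O'Shea Ch. 7 §4
Prop. 3; coordinates indexed by `σ ⊕ ι`, `Sum.inl` = the `x`'s, `Sum.inr` = the `y`'s).
[cite: CoxLittleOShea2007, Ch.7 §4 Prop. 3] -/
def relGraphIdeal : Ideal (MvPolynomial (σ ⊕ ι) k) :=
  Ideal.span (Set.range fun i => rename Sum.inl (f i) - X (Sum.inr i))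

/-- The substitution `p(x, y) ↦ p(x₁, …, xₙ, f₁, …, f_m)` of (2).
[cite: CoxLittleOShea2007, Ch.7 §4 Prop. 3, (2)] -/
def substF : MvPolynomial (σ ⊕ ι) k →ₐ[k] MvPolynomial σ k :=
  aeval (Sum.elim X f)

/-- `substF` fixes the `x`-variables. [cite: CoxLittleOShea2007, Ch.7 §4 Prop. 3, (2)] -/
@[simp] theorem substF_X_inl (j : σ) : substF f (X (Sum.inl j)) = X j := by
  simp [substF]

/-- `substF` sends `yᵢ` to `fᵢ`. [cite: CoxLittleOShea2007, Ch.7 §4 Prop. 3, (2)] -/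
@[simp] theorem substF_X_inr (i : ι) : substF f (X (Sum.inr i)) = f i := by
  simp [substF]

/-- `substF` is the identity on `k[x] ⊆ k[x, y]`. [cite: CoxLittleOShea2007, Ch.7 §4 Prop. 3, (2)] -/
@[simp] theorem substF_rename_inl (p : MvPolynomial σ k) : substF f (rename Sum.inl p) = p := by
  rw [substF, aeval_rename, Sum.elim_comp_inl, aeval_X_left, AlgHom.id_apply]

/-- On `k[y] ⊆ k[x, y]`, `substF` is `y ↦ f`. [cite: CoxLittleOShea2007, Ch.7 §4 Prop. 3, (2)] -/
@[simp] theorem substF_rename_inr (g : MvPolynomial ι k) :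
    substF f (rename Sum.inr g) = aeval f g := by
  rw [substF, aeval_rename, Sum.elim_comp_inr]

/-- Modulo `J_F` every polynomial is congruent to its substitution: `[p] = [p(x, f)]`.
[cite: CoxLittleOShea2007, Ch.7 §4 Prop. 3, proof of (2)] -/
theorem mk_relGraphIdeal_eq_mk_substF (p : MvPolynomial (σ ⊕ ι) k) :
    Ideal.Quotient.mk (relGraphIdeal f) p =
      Ideal.Quotient.mk (relGraphIdeal f) (rename Sum.inl (substF f p)) := by
  have key : Ideal.Quotient.mkₐ k (relGraphIdeal f) =
      (Ideal.Quotient.mkₐ k (relGraphIdeal f)).comp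
        ((rename Sum.inl : MvPolynomial σ k →ₐ[k] MvPolynomial (σ ⊕ ι) k).comp (substF f)) := by
    refine MvPolynomial.algHom_ext fun v => ?_
    rcases v with j | i
    · simp
    · simp only [AlgHom.comp_apply, Ideal.Quotient.mkₐ_eq_mk, substF_X_inr]
      rw [Ideal.Quotient.mk_eq_mk_iff_sub_mem, ← neg_sub]
      exact Submodule.neg_mem _ (Ideal.subset_span ⟨i, rfl⟩)
  exact DFunLike.congr_fun key p

/-- **(2)** (Cox–Little–O'Shea Ch. 7 §4, proof of Prop. 3):
`p ∈ J_F ⇔ p(x₁, …, xₙ, f₁, …, f_m) = 0` in `k[x₁, …, xₙ]`.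
[cite: CoxLittleOShea2007, Ch.7 §4 Prop. 3, (2)] -/
theorem mem_relGraphIdeal_iff (p : MvPolynomial (σ ⊕ ι) k) : p ∈ relGraphIdeal f ↔ substF f p = 0 := by
  constructor
  · intro hp
    have hle : relGraphIdeal f ≤ RingHom.ker (substF f) := by
      refine Ideal.span_le.mpr ?_
      rintro _ ⟨i, rfl⟩
      rw [SetLike.mem_coe, RingHom.mem_ker, map_sub, substF_rename_inl, substF_X_inr, sub_self]
    exact hle hp
  · intro hp
    rw [← Ideal.Quotient.eq_zero_iff_mem, mk_relGraphIdeal_eq_mk_substF, hp, map_zero, map_zero]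

/-- **Proposition 3 (i)** (Cox–Little–O'Shea Ch. 7 §4): `I_F = J_F ∩ k[y₁, …, y_m]` — the ideal of
relations is the `n`-th elimination ideal of the graph ideal (contraction along `k[y] ↪ k[x, y]`).
[cite: CoxLittleOShea2007, Ch.7 §4 Prop. 3 (i)] -/
theorem idealOfRelations_eq_comap_relGraphIdeal :
    idealOfRelations f =
      (relGraphIdeal f).comap (rename Sum.inr : MvPolynomial ι k →ₐ[k] MvPolynomial (σ ⊕ ι) k) := by
  ext g
  rw [mem_idealOfRelations_iff, Ideal.mem_comap, mem_relGraphIdeal_iff, substF_rename_inr]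

/-! ### Definition 6 and Proposition 7: the variety `V_F` -/

/-- **Definition 6** (Cox–Little–O'Shea Ch. 7 §4): the affine variety `V_F = V(I_F) ⊆ k^m`.
[cite: CoxLittleOShea2007, Ch.7 §4 Def. 6] -/
def relationVariety : Set (ι → k) :=
  zeroLocus k (idealOfRelations f)

/-- The parametrization `F : kⁿ → k^m`, `F(a) = (f₁(a), …, f_m(a))`.
[cite: CoxLittleOShea2007, Ch.7 §4 Prop. 7 (i)] -/
def generatorMap (a : σ → k) : ι → k :=
  fun i => eval a (f i)

/-- `g(F(a)) = (g(f₁, …, f_m))(a)`. [cite: CoxLittleOShea2007, Ch.7 §4 Prop. 7, proof of (iii)] -/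
theorem eval_generatorMap (g : MvPolynomial ι k) (a : σ → k) :
    eval (generatorMap f a) g = eval a (aeval f g) := by
  induction g using MvPolynomial.induction_on with
  | C c => simp
  | add p q hp hq => simp only [map_add, hp, hq]
  | mul_X p i hp => simp only [map_mul, hp, eval_X, aeval_X, generatorMap]

/-- The parametrization lands in `V_F`: `F(kⁿ) ⊆ V_F` (any field).
[cite: CoxLittleOShea2007, Ch.7 §4 Prop. 7 (i)] -/
theorem generatorMap_mem_relationVariety (a : σ → k) : generatorMap f a ∈ relationVariety f := by
  intro g hg
  rw [aeval_eq_eval, eval_generatorMap, (mem_idealOfRelations_iff f g).mp hg, map_zero]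

/-- `F(kⁿ) ⊆ V_F`. [cite: CoxLittleOShea2007, Ch.7 §4 Prop. 7 (i)] -/
theorem range_generatorMap_subset_relationVariety : Set.range (generatorMap f) ⊆ relationVariety f := by
  rintro _ ⟨a, rfl⟩
  exact generatorMap_mem_relationVariety f a

/-- Over an infinite field, `I(F(kⁿ)) = I_F`: a polynomial `g(y)` vanishes on the whole image of the
parametrization iff `g ∘ F` vanishes on `kⁿ` iff `g(f₁, …, f_m) = 0` (this is the step of the proof
of Prop. 7 (iii), quoting Ch. 4 §5 Prop. 5). [cite: CoxLittleOShea2007, Ch.7 §4 Prop. 7, proof of (iii)] -/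
theorem vanishingIdeal_range_generatorMap [Infinite k] :
    vanishingIdeal k (Set.range (generatorMap f)) = idealOfRelations f := by
  ext g
  rw [mem_vanishingIdeal_iff, mem_idealOfRelations_iff]
  constructor
  · intro h
    apply MvPolynomial.funext
    intro a
    rw [map_zero, ← eval_generatorMap]
    have := h (generatorMap f a) ⟨a, rfl⟩
    rwa [aeval_eq_eval] at this
  · rintro h _ ⟨a, rfl⟩
    rw [aeval_eq_eval, eval_generatorMap, h, map_zero]

/-- **Proposition 7 (iii)** (Cox–Little–O'Shea Ch. 7 §4; `k` infinite): `I(V_F) = I_F`, so `I_F` is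
the ideal of all polynomial functions vanishing on `V_F`. [cite: CoxLittleOShea2007, Ch.7 §4 Prop. 7 (iii)] -/
theorem vanishingIdeal_relationVariety [Infinite k] : vanishingIdeal k (relationVariety f) = idealOfRelations f := by
  refine le_antisymm ?_ (MvPolynomial.le_vanishingIdeal_zeroLocus _)
  rw [← vanishingIdeal_range_generatorMap f]
  exact MvPolynomial.vanishingIdeal_anti_mono (range_generatorMap_subset_relationVariety f)

/-- **Proposition 7 (i)** (Cox–Little–O'Shea Ch. 7 §4; `k` infinite): `V_F` is the smallest variety
of `k^m` containing the parametrization `F(kⁿ)` — any `V(I) ⊇ F(kⁿ)` contains `V_F`.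
[cite: CoxLittleOShea2007, Ch.7 §4 Prop. 7 (i)] -/
theorem relationVariety_subset_zeroLocus [Infinite k] {I : Ideal (MvPolynomial ι k)}
    (hI : Set.range (generatorMap f) ⊆ zeroLocus k I) : relationVariety f ⊆ zeroLocus k I := by
  have hle : I ≤ idealOfRelations f := by
    rw [← vanishingIdeal_range_generatorMap f]
    exact (MvPolynomial.le_vanishingIdeal_zeroLocus I).trans
      (MvPolynomial.vanishingIdeal_anti_mono hI)
  exact MvPolynomial.zeroLocus_anti_mono hle

/-- Prop. 7 (i), closure form (`k` infinite): `V_F = V(I(F(kⁿ)))` is the Zariski closure of the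
image of the parametrization. [cite: CoxLittleOShea2007, Ch.7 §4 Prop. 7 (i)] -/
theorem relationVariety_eq_zeroLocus_vanishingIdeal [Infinite k] :
    relationVariety f = zeroLocus k (vanishingIdeal k (Set.range (generatorMap f))) := by
  rw [vanishingIdeal_range_generatorMap, relationVariety]

/-- **Proposition 7 (ii)** (Cox–Little–O'Shea Ch. 7 §4; `k` infinite), in the form of Ch. 4 §5
Prop. 3 ("`V` irreducible ⇔ `I(V)` prime"): `I(V_F)` is a prime ideal.
[cite: CoxLittleOShea2007, Ch.7 §4 Prop. 7 (ii)] -/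
theorem vanishingIdeal_relationVariety_isPrime [Infinite k] : (vanishingIdeal k (relationVariety f)).IsPrime := by
  rw [vanishingIdeal_relationVariety]
  exact idealOfRelations_isPrime f

/-- **Proposition 7 (iv)** (Cox–Little–O'Shea Ch. 7 §4; `k` infinite): the coordinate ring
`k[V_F] = k[y₁, …, y_m]/I(V_F)` is isomorphic, over `k`, to `k[f₁, …, f_m]`.
[cite: CoxLittleOShea2007, Ch.7 §4 Prop. 7 (iv)] -/
def coordRingRelationVarietyEquiv [Infinite k] :
    (MvPolynomial ι k ⧸ vanishingIdeal k (relationVariety f)) ≃ₐ[k]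
      (aeval f : MvPolynomial ι k →ₐ[k] MvPolynomial σ k).range :=
  (Ideal.quotientEquivAlgOfEq k (vanishingIdeal_relationVariety f)).trans (quotIdealOfRelationsEquiv f)

end Relations

/-! ### Lemma 11: every polynomial is integral of degree `|G|` over the invariants -/

section Orbit

variable {B : Type*} [CommRing B] (G : Type*) [Group G] [Fintype G] [MulSemiringAction G B]

open Polynomial

/-- The polynomial `∏_{A ∈ G} (X − A·f)` of the proof of Lemma 11 is Mathlib's
`MulSemiringAction.charpoly G f`; it has degree exactly `N = |G|`.
[cite: CoxLittleOShea2007, Ch.7 §4 Lemma 11 (proof)] -/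
theorem natDegree_charpoly [Nontrivial B] (f : B) :
    (MulSemiringAction.charpoly G f).natDegree = Fintype.card G := by
  rw [MulSemiringAction.charpoly_eq,
    Polynomial.natDegree_prod_of_monic _ _ fun g _ => Polynomial.monic_X_sub_C (g • f)]
  simp

/-- **Lemma 11** (Cox–Little–O'Shea Ch. 7 §4): for a finite group `G` of ring automorphisms of a
commutative ring `B` (the book: a finite matrix group `G ⊆ GL(n, k)` acting on `k[x₁, …, xₙ]` by
`(A · f)(x) = f(A · x)`), `N = |G|`, and any `f ∈ B` there is a monic polynomial of degree `N` with
`G`-invariant coefficients `g₁, …, g_N ∈ B^G` such that `f^N + g₁ f^{N−1} + ⋯ + g_N = 0` — namely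
`∏_{A ∈ G} (X − A·f)` (Mathlib's `MulSemiringAction.charpoly`, whose monicity, invariance and
vanishing at `f` are `monic_charpoly`, `smul_coeff_charpoly`, `eval_charpoly`).
[cite: CoxLittleOShea2007, Ch.7 §4 Lemma 11] -/
theorem exists_monic_invariant_coeff_eval_eq_zero [Nontrivial B] (f : B) :
    ∃ p : B[X], p.Monic ∧ p.natDegree = Fintype.card G ∧
      (∀ h : G, ∀ i : ℕ, h • p.coeff i = p.coeff i) ∧ p.eval f = 0 :=
  ⟨MulSemiringAction.charpoly G f, MulSemiringAction.monic_charpoly G f, natDegree_charpoly G f,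
    fun h i => MulSemiringAction.smul_coeff_charpoly f i h, MulSemiringAction.eval_charpoly G f⟩

end Orbit

/-! ### Definition 9 and Theorem 10: the orbit space `kⁿ/G` and `V_F` -/

section PointOrbitSpace

variable {k : Type*} [Field k] {σ ι : Type*} (f : ι → MvPolynomial σ k)
variable (G : Type*) [Group G] [MulSemiringAction G (MvPolynomial σ k)]
  [SMulCommClass G k (MvPolynomial σ k)]

open Pointwise

/-- A `k`-algebra action of `G` on `k[x₁, …, xₙ]` moves points of `kⁿ`: `(g ⋆ a)ᵢ = (g⁻¹ • xᵢ)(a)`, so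
that `p(g ⋆ a) = (g⁻¹ • p)(a)` (`eval_pointAction`). For a finite matrix group `G ⊆ GL(n, k)` acting on
polynomials by `(A • f)(x) = f(A⁻¹ · x)` this is the book's action `a ↦ A · a` on `kⁿ` by matrix
multiplication. [cite: CoxLittleOShea2007, Ch.7 §4 Def. 9 (the action of G on kⁿ)] -/
def pointAction (g : G) (a : σ → k) : σ → k :=
  fun i => eval a (g⁻¹ • X i)

/-- `p(g ⋆ a) = (g⁻¹ • p)(a)`. [cite: CoxLittleOShea2007, Ch.7 §4 Def. 9 (the action of G on kⁿ)] -/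
theorem eval_pointAction (g : G) (a : σ → k) (p : MvPolynomial σ k) :
    eval (pointAction G g a) p = eval a (g⁻¹ • p) := by
  have key : (aeval (pointAction G g a) : MvPolynomial σ k →ₐ[k] k) =
      (aeval a).comp (MulSemiringAction.toAlgHom k (MvPolynomial σ k) g⁻¹) := by
    refine MvPolynomial.algHom_ext fun i => ?_
    rw [aeval_X, AlgHom.comp_apply, MulSemiringAction.toAlgHom_apply]
    rfl
  have h := DFunLike.congr_fun key p
  rw [AlgHom.comp_apply, MulSemiringAction.toAlgHom_apply] at h
  exact h

omit [SMulCommClass G k (MvPolynomial σ k)] in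
/-- `1 ⋆ a = a`. [cite: CoxLittleOShea2007, Ch.7 §4 Def. 9 (∼_G is reflexive)] -/
@[simp] theorem one_pointAction (a : σ → k) : pointAction G 1 a = a := by
  funext i
  simp [pointAction]

/-- `(g h) ⋆ a = g ⋆ (h ⋆ a)`. [cite: CoxLittleOShea2007, Ch.7 §4 Def. 9 (∼_G is transitive)] -/
theorem mul_pointAction (g h : G) (a : σ → k) :
    pointAction G (g * h) a = pointAction G g (pointAction G h a) := by
  funext i
  show eval a ((g * h)⁻¹ • X i) = eval (pointAction G h a) (g⁻¹ • X i)
  rw [eval_pointAction, mul_inv_rev, mul_smul]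

/-- **Definition 9** (Cox–Little–O'Shea Ch. 7 §4): the `G`-orbit `G · a = {g ⋆ a : g ∈ G}` of a point
`a ∈ kⁿ`. [cite: CoxLittleOShea2007, Ch.7 §4 Def. 9] -/
def pointOrbit (a : σ → k) : Set (σ → k) :=
  Set.range fun g : G => pointAction G g a

omit [SMulCommClass G k (MvPolynomial σ k)] in
/-- `b ∈ G · a ⇔ b = g ⋆ a` for some `g ∈ G` (the relation `b ∼_G a`).
[cite: CoxLittleOShea2007, Ch.7 §4 Def. 9] -/
theorem mem_pointOrbit_iff (a b : σ → k) : b ∈ pointOrbit G a ↔ ∃ g : G, pointAction G g a = b :=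
  Iff.rfl

omit [SMulCommClass G k (MvPolynomial σ k)] in
/-- `a ∈ G · a`. [cite: CoxLittleOShea2007, Ch.7 §4 Def. 9 (∼_G is reflexive)] -/
theorem mem_pointOrbit_self (a : σ → k) : a ∈ pointOrbit G a :=
  ⟨1, one_pointAction G a⟩

/-- `∼_G` is an equivalence relation on `kⁿ` (its classes are the orbits).
[cite: CoxLittleOShea2007, Ch.7 §4 Def. 9 (∼_G is an equivalence relation)] -/
def pointOrbitRel : Setoid (σ → k) where
  r a b := b ∈ pointOrbit G a
  iseqv :=
    { refl := fun a => mem_pointOrbit_self G a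
      symm := by
        rintro a b ⟨g, rfl⟩
        refine ⟨g⁻¹, ?_⟩
        show pointAction G g⁻¹ (pointAction G g a) = a
        rw [← mul_pointAction, inv_mul_cancel, one_pointAction]
      trans := by
        rintro a b c ⟨g, rfl⟩ ⟨h, rfl⟩
        exact ⟨h * g, mul_pointAction G h g a⟩ }

/-- **Definition 9** (Cox–Little–O'Shea Ch. 7 §4): the *orbit space* `kⁿ/G`, the set of `G`-orbits,
i.e. the quotient of `kⁿ` by `∼_G`. [cite: CoxLittleOShea2007, Ch.7 §4 Def. 9] -/
def PointOrbitSpace (k σ : Type*) [Field k] (G : Type*) [Group G] [MulSemiringAction G (MvPolynomial σ k)]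
    [SMulCommClass G k (MvPolynomial σ k)] : Type _ :=
  Quotient (pointOrbitRel (k := k) (σ := σ) G)

/-- A `k`-algebra automorphism commutes with substitution: `g • h(f₁, …, f_m) = h(g • f₁, …, g • f_m)`.
[cite: CoxLittleOShea2007, Ch.7 §4 Thm. 10, proof of (ii) (invariants take the same value on an orbit)] -/
theorem smul_aeval_eq_aeval_smul (g : G) (h : MvPolynomial ι k) :
    g • aeval f h = aeval (fun i => g • f i) h := by
  have key : (MulSemiringAction.toAlgHom k (MvPolynomial σ k) g).comp (aeval f) =
      aeval (fun i => g • f i) := by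
    refine MvPolynomial.algHom_ext fun i => ?_
    rw [AlgHom.comp_apply, aeval_X, aeval_X, MulSemiringAction.toAlgHom_apply]
  have := DFunLike.congr_fun key h
  rwa [AlgHom.comp_apply, MulSemiringAction.toAlgHom_apply] at this

variable {f G}

/-- If the `fᵢ` are invariant then so is every element of `k[f₁, …, f_m]`.
[cite: CoxLittleOShea2007, Ch.7 §4 Thm. 10, proof of (ii)] -/
theorem smul_eq_self_of_mem_range_aeval (hf : ∀ (i : ι) (g : G), g • f i = f i) (g : G)
    {x : MvPolynomial σ k} (hx : x ∈ (aeval f : MvPolynomial ι k →ₐ[k] MvPolynomial σ k).range) :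
    g • x = x := by
  obtain ⟨h, rfl⟩ := (AlgHom.mem_range _).mp hx
  rw [smul_aeval_eq_aeval_smul]
  exact congrArg (fun u => aeval u h) (funext fun i => hf i g)

/-- Invariants take the same value on all points of an orbit: `F(g ⋆ a) = F(a)`.
[cite: CoxLittleOShea2007, Ch.7 §4 Thm. 10 (ii) (F̃ is well defined)] -/
theorem generatorMap_pointAction (hf : ∀ (i : ι) (g : G), g • f i = f i) (g : G) (a : σ → k) :
    generatorMap f (pointAction G g a) = generatorMap f a := by
  funext i
  rw [generatorMap, generatorMap, eval_pointAction, hf i g⁻¹]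

/-- The ideal of a moved point: `I({g ⋆ a}) = g • I({a})`.
[cite: CoxLittleOShea2007, Ch.7 §4 Thm. 10, proof of (ii)] -/
theorem vanishingIdeal_pointAction (g : G) (a : σ → k) :
    vanishingIdeal k ({pointAction G g a} : Set (σ → k)) = g • vanishingIdeal k ({a} : Set (σ → k)) := by
  ext p
  rw [Ideal.mem_pointwise_smul_iff_inv_smul_mem, mem_vanishingIdeal_iff, mem_vanishingIdeal_iff]
  simp only [Set.mem_singleton_iff, forall_eq]
  rw [aeval_eq_eval, aeval_eq_eval, eval_pointAction]

/-- A point is determined by its ideal: `I({a}) = I({b}) ⇒ a = b` (for an arbitrary index type; the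
tree's `Literature.RingTheory.Elimination.TopComponents.eq_of_vanishingIdeal_singleton_eq` is the case
`Fin n`, kept private here to avoid a public twin). [cite: CoxLittleOShea2007, Ch.7 §4 Thm. 10, proof of (ii)] -/
private theorem point_eq_of_vanishingIdeal_singleton_eq {a b : σ → k}
    (h : vanishingIdeal k ({a} : Set (σ → k)) = vanishingIdeal k ({b} : Set (σ → k))) : a = b := by
  funext i
  have hmem : X i - C (a i) ∈ vanishingIdeal k ({a} : Set (σ → k)) := by
    rw [mem_vanishingIdeal_iff]
    simp
  rw [h, mem_vanishingIdeal_iff] at hmem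
  have := hmem b rfl
  simp only [map_sub, aeval_X, aeval_C, Algebra.algebraMap_self, RingHom.id_apply] at this
  exact (sub_eq_zero.mp this).symm

omit [SMulCommClass G k (MvPolynomial σ k)] in
/-- The hypothesis `k[x]^G = k[f₁, …, f_m]` of Theorem 10 makes `k[x] ⊇ k[f₁, …, f_m]` an invariant
extension in Mathlib's sense. [cite: CoxLittleOShea2007, Ch.7 §4 Thm. 10 (hypothesis)] -/
theorem isInvariant_range
    (hGf : ∀ p : MvPolynomial σ k, (∀ g : G, g • p = p) →
      p ∈ (aeval f : MvPolynomial ι k →ₐ[k] MvPolynomial σ k).range) :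
    Algebra.IsInvariant (aeval f : MvPolynomial ι k →ₐ[k] MvPolynomial σ k).range
      (MvPolynomial σ k) G :=
  ⟨fun b hb => ⟨⟨b, hGf b hb⟩, rfl⟩⟩

/-- With invariant `fᵢ`, the `G`-action commutes with the `k[f₁, …, f_m]`-module structure of `k[x]`.
[cite: CoxLittleOShea2007, Ch.7 §4 Thm. 10 (hypothesis)] -/
theorem smulCommClass_range (hf : ∀ (i : ι) (g : G), g • f i = f i) :
    SMulCommClass G (aeval f : MvPolynomial ι k →ₐ[k] MvPolynomial σ k).range (MvPolynomial σ k) :=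
  ⟨fun g x b => by
    rw [Algebra.smul_def, Algebra.smul_def, smul_mul', Subalgebra.algebraMap_apply,
      smul_eq_self_of_mem_range_aeval hf g x.2]⟩

/-- **Theorem 10 (ii)** (Cox–Little–O'Shea Ch. 7 §4): if `G` is finite and `k[x]^G = k[f₁, …, f_m]`, then
`F(a) = F(b)` iff `b ∈ G · a`; i.e. `G · a ↦ F(a)` is a well-defined injection of the orbit space into
`V_F`. (The book assumes `k` algebraically closed of characteristic zero and separates orbits with the
Reynolds operator; the proof here, valid over any field, is Mathlib's transitivity of `G` on the primes of
`k[x]` lying over a fixed prime of the ring of invariants, applied to the maximal ideals of the two points.)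
[cite: CoxLittleOShea2007, Ch.7 §4 Thm. 10 (ii)] -/
theorem generatorMap_eq_generatorMap_iff [Finite G]
    (hGf : ∀ p : MvPolynomial σ k, (∀ g : G, g • p = p) →
      p ∈ (aeval f : MvPolynomial ι k →ₐ[k] MvPolynomial σ k).range)
    (hf : ∀ (i : ι) (g : G), g • f i = f i) (a b : σ → k) :
    generatorMap f a = generatorMap f b ↔ b ∈ pointOrbit G a := by
  constructor
  · intro hab
    haveI := isInvariant_range (G := G) hGf
    haveI := smulCommClass_range (G := G) hf
    have hPQ : (vanishingIdeal k ({a} : Set (σ → k))).under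
          (aeval f : MvPolynomial ι k →ₐ[k] MvPolynomial σ k).range =
        (vanishingIdeal k ({b} : Set (σ → k))).under
          (aeval f : MvPolynomial ι k →ₐ[k] MvPolynomial σ k).range := by
      ext x
      obtain ⟨h, hh⟩ := (AlgHom.mem_range _).mp x.2
      simp only [Ideal.under_def, Ideal.mem_comap, Subalgebra.algebraMap_apply, mem_vanishingIdeal_iff,
        Set.mem_singleton_iff, forall_eq]
      rw [← hh, aeval_eq_eval, aeval_eq_eval, ← eval_generatorMap, ← eval_generatorMap, hab]
    obtain ⟨g, hg⟩ := Algebra.IsInvariant.exists_smul_of_under_eq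
      (A := (aeval f : MvPolynomial ι k →ₐ[k] MvPolynomial σ k).range) (B := MvPolynomial σ k) (G := G)
      (P := vanishingIdeal k ({a} : Set (σ → k))) (Q := vanishingIdeal k ({b} : Set (σ → k))) hPQ
    refine ⟨g, point_eq_of_vanishingIdeal_singleton_eq ?_⟩
    rw [vanishingIdeal_pointAction, ← hg]
  · rintro ⟨g, rfl⟩
    exact (generatorMap_pointAction hf g a).symm

omit [SMulCommClass G k (MvPolynomial σ k)] in
/-- **Theorem 10 (i)** (Cox–Little–O'Shea Ch. 7 §4): for `k` algebraically closed, `G` finite and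
`k[x]^G = k[f₁, …, f_m]`, the parametrization `F : kⁿ → V_F` is ONTO — every point of `V_F = V(I_F)`
is of the form `(f₁(a), …, f_m(a))` (there are no missing points). (The book extends `b ∈ V(I_F)` to
`V(J_F)` with the Extension Theorem using the monic relations of Lemma 11; here: `k[x]` is integral over
`k[f₁, …, f_m]` (Lemma 11, Mathlib's `Algebra.IsInvariant.isIntegral`), so the maximal ideal of `b` in
`k[f₁, …, f_m] ≅ k[y]/I_F` lies under a maximal ideal of `k[x]`, which by the Nullstellensatz is the ideal
of a point `a`, and then `F(a) = b`.) [cite: CoxLittleOShea2007, Ch.7 §4 Thm. 10 (i)] -/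
theorem exists_generatorMap_eq [IsAlgClosed k] [Finite σ] [Finite G]
    (hGf : ∀ p : MvPolynomial σ k, (∀ g : G, g • p = p) →
      p ∈ (aeval f : MvPolynomial ι k →ₐ[k] MvPolynomial σ k).range)
    {b : ι → k} (hb : b ∈ relationVariety f) : ∃ a : σ → k, generatorMap f a = b := by
  haveI := isInvariant_range (G := G) hGf
  haveI : Algebra.IsIntegral (aeval f : MvPolynomial ι k →ₐ[k] MvPolynomial σ k).range
      (MvPolynomial σ k) :=
    Algebra.IsInvariant.isIntegral _ (MvPolynomial σ k) G
  -- the point `b ∈ V(I_F)` is a `k`-algebra map `ψ : k[f₁, …, f_m] ≅ k[y]/I_F → k`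
  have hker : ∀ p ∈ idealOfRelations f, (aeval b : MvPolynomial ι k →ₐ[k] k) p = 0 :=
    fun p hp => hb p hp
  let ψ : (aeval f : MvPolynomial ι k →ₐ[k] MvPolynomial σ k).range →ₐ[k] k :=
    (Ideal.Quotient.liftₐ (idealOfRelations f) (aeval b) hker).comp
      ((quotIdealOfRelationsEquiv f).symm : _ →ₐ[k] MvPolynomial ι k ⧸ idealOfRelations f)
  have hψ : ∀ h : MvPolynomial ι k, ψ ⟨aeval f h, (AlgHom.mem_range _).mpr ⟨h, rfl⟩⟩ = aeval b h := by
    intro h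
    have hs : (quotIdealOfRelationsEquiv f).symm ⟨aeval f h, (AlgHom.mem_range _).mpr ⟨h, rfl⟩⟩ =
        Ideal.Quotient.mk (idealOfRelations f) h := by
      rw [AlgEquiv.symm_apply_eq]
      exact Subtype.ext (quotIdealOfRelationsEquiv_mk f h).symm
    show Ideal.Quotient.liftₐ (idealOfRelations f) (aeval b) hker
      ((quotIdealOfRelationsEquiv f).symm ⟨aeval f h, (AlgHom.mem_range _).mpr ⟨h, rfl⟩⟩) = aeval b h
    rw [hs, Ideal.Quotient.liftₐ_apply, Ideal.Quotient.lift_mk]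
    rfl
  -- its kernel is a maximal ideal; choose a maximal ideal of `k[x]` over it and its point `a`
  have hsurj : Function.Surjective ψ := fun c => ⟨algebraMap k _ c, ψ.commutes c⟩
  haveI : (RingHom.ker ψ).IsMaximal := RingHom.ker_isMaximal_of_surjective ψ hsurj
  obtain ⟨Q, hQmax, hQ⟩ := Ideal.exists_ideal_over_maximal_of_isIntegral (S := MvPolynomial σ k)
    (RingHom.ker ψ) (by
      intro x hx
      rw [RingHom.mem_ker, Subalgebra.algebraMap_apply, ZeroMemClass.coe_eq_zero] at hx
      rw [hx]
      exact zero_mem _)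
  obtain ⟨a, ha⟩ := (MvPolynomial.isMaximal_iff_eq_vanishingIdeal_singleton (I := Q)).mp hQmax
  refine ⟨a, funext fun i => ?_⟩
  -- `fᵢ − bᵢ ∈ ker ψ ⊆ Q = I({a})`, so `fᵢ(a) = bᵢ`
  have hmem : (⟨aeval f (X i - C (b i)), (AlgHom.mem_range _).mpr ⟨X i - C (b i), rfl⟩⟩ :
      (aeval f : MvPolynomial ι k →ₐ[k] MvPolynomial σ k).range) ∈ RingHom.ker ψ := by
    rw [RingHom.mem_ker, hψ]
    simp
  rw [← hQ, Ideal.mem_comap, Subalgebra.algebraMap_apply, ha, mem_vanishingIdeal_iff] at hmem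
  have h0 := hmem a rfl
  simp only [map_sub, aeval_X, aeval_C, algebraMap_eq, Algebra.algebraMap_self, RingHom.id_apply] at h0
  exact sub_eq_zero.mp h0

/-- **Theorem 10** (Cox–Little–O'Shea Ch. 7 §4): for a finite group `G` acting on `k[x₁, …, xₙ]` by
`k`-algebra automorphisms with `k[x]^G = k[f₁, …, f_m]`, `k` algebraically closed, the map
`G · a ↦ F(a)` is a ONE-TO-ONE CORRESPONDENCE `kⁿ/G ≅ V_F` between the orbit space and the affine variety
`V_F`. [cite: CoxLittleOShea2007, Ch.7 §4 Thm. 10 (ii) (kⁿ/G ≅ V_F)] -/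
noncomputable def pointOrbitSpaceEquiv [IsAlgClosed k] [Finite σ] [Finite G]
    (hGf : ∀ p : MvPolynomial σ k, (∀ g : G, g • p = p) →
      p ∈ (aeval f : MvPolynomial ι k →ₐ[k] MvPolynomial σ k).range)
    (hf : ∀ (i : ι) (g : G), g • f i = f i) :
    PointOrbitSpace k σ G ≃ relationVariety f :=
  Equiv.ofBijective
    (Quotient.lift (fun a => (⟨generatorMap f a, generatorMap_mem_relationVariety f a⟩ : relationVariety f))
      fun a b hab => Subtype.ext ((generatorMap_eq_generatorMap_iff hGf hf a b).mpr hab))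
    ⟨fun x y => Quotient.inductionOn₂ x y fun a b hab =>
        Quotient.sound ((generatorMap_eq_generatorMap_iff hGf hf a b).mp (congrArg Subtype.val hab)),
      fun b => by
        obtain ⟨a, ha⟩ := exists_generatorMap_eq (G := G) hGf b.2
        exact ⟨Quotient.mk _ a, Subtype.ext ha⟩⟩

/-- The correspondence of Theorem 10 sends the orbit `G · a` to `F(a)`.
[cite: CoxLittleOShea2007, Ch.7 §4 Thm. 10 (ii) (definition of F̃)] -/
theorem pointOrbitSpaceEquiv_mk [IsAlgClosed k] [Finite σ] [Finite G]
    (hGf : ∀ p : MvPolynomial σ k, (∀ g : G, g • p = p) →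
      p ∈ (aeval f : MvPolynomial ι k →ₐ[k] MvPolynomial σ k).range)
    (hf : ∀ (i : ι) (g : G), g • f i = f i) (a : σ → k) :
    (pointOrbitSpaceEquiv hGf hf (Quotient.mk (pointOrbitRel G) a) : ι → k) = generatorMap f a :=
  rfl

end PointOrbitSpace

end Literature.RingTheory.MvPolynomial.RelationsAmongGenerators

end
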